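import Mathlib.RingTheory.Algebraic.Basic
import Mathlib.RingTheory.MvPolynomial.Homogeneous
import Mathlib.Data.Finsupp.Option
import HarnessLib

/-!
# Substituting a linear form with a transcendental coefficient is injective

Topic `Literature/RingTheory/AlgebraicIndependent`. Let `K → E` be commutative rings and
`c : ι → E` a finite family one of whose members `c i₁` is transcendental over `K`. Then the
`K`-algebra homomorphism
`K[Y, (X_j)_{j ∈ ι}] → E[(X_j)_{j ∈ ι}]`, `Y ↦ Σ_j c_j X_j`, `X_j ↦ X_j`,
is injective (`aeval_linearForm_injective`): equivalently the linear form `Σ_j c_j X_j` and the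
variables `X_j` are algebraically independent over `K`. This is the algebra behind "the generic
member `Σ_j t_j h_j = 0` of a linear system passes through every point of the blown-up variety that
is not closed in its fibre" (used for the section criterion of route `SectionAscent` of the summit
`ResolutionOfSingularities`): a point with a coordinate ratio `h₁/h₀` transcendental over the ground
field lies under a point of the generic member over the function field `K(t)`.

Proof (leading coefficient, no field theory; compare `GenericLinearForms.lean` in this directory):
if `F(Σ c_j X_j, X) = 0` with `F ≠ 0`, let `N` be the largest value of `deg_Y + deg_{X_{i₁}}` on the
support of `F`, attained at a monomial `m₀`; the coefficient of `X_{i₁}^N · ∏_{j ≠ i₁} X_j^{m₀ j}` in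
`F(Σ c_j X_j, X)` is `P(c_{i₁})` for a nonzero polynomial `P ∈ K[Y]` (the binomial expansion of
`(c_{i₁} X_{i₁} + …)^k` contributes to this monomial only through its top term `c_{i₁}^k X_{i₁}^k`,
`coeff_single_linearForm_pow`), contradicting transcendence.

## References

* [HodgePedoe1994] W. V. D. Hodge, D. Pedoe, *Methods of Algebraic Geometry* II, Ch. X §6 (generic
  linear forms in independent coefficients; the present statement is the one-transcendental-
  coefficient variant, folklore).
-/

open MvPolynomial

namespace Literature.RingTheory.AlgebraicIndependent

/-- The coefficient of `X_i^k` in `(Σ_j c_j X_j)^k` is `c_i^k`. [folklore] -/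
theorem coeff_single_linearForm_pow {E : Type*} [CommRing E] {ι : Type*} [Fintype ι]
    [DecidableEq ι] (c : ι → E) (i : ι) (k : ℕ) :
    coeff (Finsupp.single i k) ((∑ j, C (c j) * X j) ^ k) = c i ^ k := by
  induction k with
  | zero => simp
  | succ k ih =>
    rw [pow_succ, Finset.mul_sum, coeff_sum]
    rw [Finset.sum_eq_single i]
    · rw [mul_left_comm, coeff_C_mul, coeff_mul_X', if_pos (by simp),
        show Finsupp.single i (k + 1) - Finsupp.single i 1 = Finsupp.single i k by
          rw [← Finsupp.single_tsub, Nat.add_sub_cancel], ih, pow_succ, mul_comm]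
    · intro j _ hj
      rw [mul_left_comm, coeff_C_mul, coeff_mul_X', if_neg, mul_zero]
      rw [Finsupp.mem_support_iff, Finsupp.single_apply, if_neg (Ne.symm hj)]
      exact fun h => h rfl
    · intro h; exact absurd (Finset.mem_univ i) h

/-- **Key algebra lemma.** Let `K → E` be commutative rings, `c : ι → E` a finite family one of
whose members `c i₁` is transcendental over `K`. Then the `K`-algebra map
`K[Y, (X_j)_j] → E[(X_j)_j]`, `Y ↦ Σ_j c_j X_j`, `X_j ↦ X_j` is injective: a relation
`F(Σ c_j X_j, X) = 0` would, on the coefficient of `X_{i₁}^N X^{m₀'}` for `N` the largest value of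
`deg_Y + deg_{X_{i₁}}` on the support of `F` (attained at `m₀`), give a nonzero polynomial over `K`
annihilating `c_{i₁}`. [folklore] -/
theorem aeval_linearForm_injective {K E : Type*} [CommRing K] [CommRing E] [Algebra K E]
    {ι : Type*} [Fintype ι] [DecidableEq ι] (c : ι → E) (i₁ : ι)
    (hc : Transcendental K (c i₁)) :
    Function.Injective (aeval (R := K)
      (fun o : Option ι => o.elim (∑ j, C (c j) * X j) X) :
        MvPolynomial (Option ι) K → MvPolynomial ι E) := by
  classical
  set L : MvPolynomial ι E := ∑ j, C (c j) * X j with hL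
  set ψ := aeval (R := K) (fun o : Option ι => o.elim L X) with hψ
  rw [injective_iff_map_eq_zero]
  intro F hF
  by_contra hF0
  -- the weight `m none + m (some i₁)` and a maximiser `m₀` on the support
  let wt : (Option ι →₀ ℕ) → ℕ := fun m => m none + m (some i₁)
  have hsupp : F.support.Nonempty :=
    Finset.nonempty_of_ne_empty (fun h => hF0 (support_eq_empty.mp h))
  obtain ⟨m₀, hm₀, hmax⟩ := Finset.exists_max_image F.support wt hsupp
  set N := wt m₀ with hN
  -- the target monomial `X_{i₁}^N · ∏_{j ≠ i₁} X_j^{m₀ j}`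
  let μ : ι →₀ ℕ := (Finsupp.some m₀).update i₁ N
  have hμi : μ i₁ = N := by simp [μ]
  have hμj : ∀ j, j ≠ i₁ → μ j = m₀ (some j) := fun j hj => by simp [μ, hj]
  -- the condition singling out the contributing monomials
  let cond : (Option ι →₀ ℕ) → Prop := fun m =>
    (∀ j, j ≠ i₁ → m (some j) = m₀ (some j)) ∧ wt m = N
  -- `ψ` on monomials
  have hψmon : ∀ (m : Option ι →₀ ℕ) (a : K), ψ (monomial m a) =
      C (algebraMap K E a) * (L ^ (m none) * monomial m.some 1) := by
    intro m a
    rw [hψ, aeval_monomial, MvPolynomial.algebraMap_apply,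
      Finsupp.prod_option_index m (fun o k => (Option.elim o L X) ^ k) (fun _ => pow_zero _)
        (fun _ _ _ => pow_add _ _ _)]
    simp only [Option.elim]
    rw [← prod_X_pow_eq_monomial]
    rfl
  have hLhom : L.IsHomogeneous 1 :=
    IsHomogeneous.sum _ _ _ fun j _ => isHomogeneous_C_mul_X (c j) j
  -- the coefficient of `μ` in `ψ(X^m)` for `m` in the support
  have hcoeff : ∀ m ∈ F.support,
      coeff μ (L ^ (m none) * monomial m.some 1) = if cond m then c i₁ ^ (m none) else 0 := by
    intro m hm
    have hwt : wt m ≤ N := hmax m hm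
    rw [coeff_mul_monomial', mul_one]
    by_cases hle : m.some ≤ μ
    · rw [if_pos hle]
      set γ := μ - m.some with hγ
      have hsum : m.some + γ = μ := add_tsub_cancel_of_le hle
      have hγi : m (some i₁) + γ i₁ = N := by
        have := congrArg (fun f => f i₁) hsum
        simpa [hμi] using this
      have hγj : ∀ j, j ≠ i₁ → m (some j) + γ j = m₀ (some j) := fun j hj => by
        have := congrArg (fun f => f j) hsum
        simpa [hμj j hj] using this
      by_cases hdeg : γ.degree = m none
      · -- then `γ = single i₁ (m none)` and `cond m` holds
        have hki : γ i₁ = m none := by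
          apply le_antisymm
          · exact hdeg ▸ Finsupp.le_degree i₁ γ
          · have : m none + m (some i₁) ≤ m (some i₁) + γ i₁ := hγi ▸ hwt
            omega
        have hγeq : γ = Finsupp.single i₁ (m none) := by
          have hle' : Finsupp.single i₁ (m none) ≤ γ := Finsupp.single_le_iff.mpr hki.ge
          have h0 : γ - Finsupp.single i₁ (m none) = 0 := by
            rw [← Finsupp.degree_eq_zero_iff]
            have := congrArg Finsupp.degree (add_tsub_cancel_of_le hle')
            rw [map_add, Finsupp.degree_single, hdeg] at this
            omega
          rw [← add_tsub_cancel_of_le hle', h0, add_zero]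
        have hcond : cond m := by
          refine ⟨fun j hj => ?_, ?_⟩
          · have := hγj j hj
            rw [hγeq, Finsupp.single_apply, if_neg (Ne.symm hj), add_zero] at this
            exact this
          · change m none + m (some i₁) = N
            rw [← hγi, hki]; ring
        rw [if_pos hcond, hγeq, coeff_single_linearForm_pow]
      · rw [(hLhom.pow (m none)).coeff_eq_zero (by rwa [one_mul]), if_neg]
        rintro ⟨hc1, hc2⟩
        apply hdeg
        have hki : γ i₁ = m none := by
          change m none + m (some i₁) = N at hc2
          omega
        have hγeq : γ = Finsupp.single i₁ (m none) := by
          ext j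
          by_cases hj : j = i₁
          · subst hj; rw [Finsupp.single_eq_same, hki]
          · rw [Finsupp.single_apply, if_neg (Ne.symm hj)]
            have := hγj j hj
            rw [hc1 j hj] at this
            omega
        rw [hγeq, Finsupp.degree_single]
    · rw [if_neg hle, if_neg]
      rintro ⟨hc1, hc2⟩
      apply hle
      intro j
      by_cases hj : j = i₁
      · subst hj
        rw [Finsupp.some_apply, hμi]
        change m none + m (some j) = N at hc2
        omega
      · rw [Finsupp.some_apply, hμj j hj, hc1 j hj]
  -- the coefficient of `μ` in `ψ F`
  have hψF : coeff μ (ψ F) =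
      ∑ m ∈ F.support.filter cond, algebraMap K E (coeff m F) * c i₁ ^ (m none) := by
    conv_lhs => rw [F.as_sum, map_sum, coeff_sum]
    rw [Finset.sum_filter]
    refine Finset.sum_congr rfl fun m hm => ?_
    rw [hψmon, coeff_C_mul, hcoeff m hm, mul_ite, mul_zero]
  -- the polynomial over `K` annihilating `c i₁`
  let P : Polynomial K := ∑ m ∈ F.support.filter cond, Polynomial.monomial (m none) (coeff m F)
  have hPeval : Polynomial.aeval (c i₁) P = 0 := by
    change Polynomial.aeval (c i₁) (∑ m ∈ F.support.filter cond,
      Polynomial.monomial (m none) (coeff m F)) = 0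
    rw [map_sum]
    simp only [Polynomial.aeval_monomial]
    rw [← hψF, hF, coeff_zero]
  have hm₀cond : m₀ ∈ F.support.filter cond := by
    rw [Finset.mem_filter]
    exact ⟨hm₀, fun j _ => rfl, rfl⟩
  have hPne : P ≠ 0 := by
    intro hP
    have h := congrArg (fun Q => Polynomial.coeff Q (m₀ none)) hP
    simp only [P, Polynomial.finsetSum_coeff, Polynomial.coeff_monomial,
      Polynomial.coeff_zero] at h
    rw [Finset.sum_eq_single_of_mem m₀ hm₀cond] at h
    · rw [if_pos rfl] at h
      exact (mem_support_iff.mp hm₀) h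
    · intro m hm hne
      rw [if_neg]
      intro heq
      apply hne
      rw [Finset.mem_filter] at hm
      obtain ⟨-, hc1, hc2⟩ := hm
      ext o
      rcases o with _ | j
      · exact heq
      · by_cases hj : j = i₁
        · subst hj
          change m none + m (some j) = m₀ none + m₀ (some j) at hc2
          omega
        · exact hc1 j hj
  exact hc ⟨P, hPne, hPeval⟩

end Literature.RingTheory.AlgebraicIndependent
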